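import Summits.QuantumFields.BalabanUV.T4Continuum.Support.NE7K1LinWalkProfile
import Literature.MathematicalPhysics.QuantumFieldTheory.Balaban1983to89.B4Lower18
import Literature.Probability.LatticeModels.LeeYangFirstZeroLimitDerivatives

/-!
# NE7K1LinWalkCubes — row NE7 (node U5), candidate route HOM, path H1L, cell K1-lin(s): THE PRODUCT CUT-OFFS `Π_μ Φ(x_μ∕W − 2J_μ + 1)`
# ON `ℤ^{d+1}` — bounded, Lipschitz `4∕W` per unit of `ℓ¹`-distance, axis second differences `≤ 32∕W²`, FLAT at the faces of an
# aligned box (Neumann compatibility), supported in the cube `Π((2J_μ−1)W, (2J_μ+2)W)`, and a PARTITION OF UNITY on the box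

Lineage `b2b-balaban-t4-ne7-p2` (CRUX PROVER NE7 #2), generation 68; series (RW) file 6 (over `NE7K1LinWalkProfile` and the lattice
vocabulary of `B4Reflection242` ∕ `B4BoxCov237` ∕ `B4Lower18`: `nbrs`, `uvec`, `blk`, `boxDom`).  B4 ([Balaban1983RegularityDecay] p. 575)
uses cut-offs `h_j` attached to the cubes `□_j` of side `~M` with `|∂h_j| = O(M^{−1})`, `|Δh_j| = O(M^{−2})`; here `W` = the number of
lattice sites per profile unit (file 7 takes `W = M·n` for mesh `1∕n`), labels `J ∈ ℕ^{d+1}`, and every estimate is explicit: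

* `cut W J x = Π_μ Φ(x_μ∕W − 2J_μ + 1)`; `cut_mem_Icc` (`0 ≤ cut ≤ 1`); telescoping `|Πf − Πg| ≤ Σ|f − g|` for factors bounded by `1` is
  the tree's `Literature.Probability.LatticeModels.JiangNewman.abs_prod_sub_prod_le` BY NAME; **`abs_cut_sub_cut_le`** `|cut x − cut y| ≤ (4∕W)·Σ_μ|x_μ − y_μ|`; `abs_cut_sub_cut_of_mem_nbrs` (`≤ 4∕W` across a
  bond); `abs_sub_le_of_blk_eq` + **`abs_cut_sub_cut_of_blk_eq`** (`≤ 4(d+1)n∕W` inside an `n`-block).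
* **`abs_cut_secondDiff_le`** `|cut(x+e_μ) + cut(x−e_μ) − 2cut(x)| ≤ 32∕W²` (one factor moves, the others are common and bounded by `1`).
* **`cut_add_uvec_eq_of_eq_zero`**, **`cut_sub_uvec_eq_of_eq_top`** — at a lower face `x_μ = 0` and at an upper face `x_μ = (2K+1)W − 1` of
  the ALIGNED box `Π_μ[0,(2K_μ+1)W)` the cut-off does not change across the (missing) bond: `Φ`'s plateaus ∕ zero-sets cover `[2k, 2k+1]`
  (`NE7K1LinWalkProfile.Phi_flat_int`); hence **`abs_dirDiff_le`**: the μ-directional NEUMANN second difference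
  `[x+e_μ ∈ box](cut x − cut(x+e_μ)) + [x−e_μ ∈ box](cut x − cut(x−e_μ))` is `≤ 32∕W²` at EVERY site of the box (interior: a full second
  difference; face: zero) — B4's `|Δh_j| = O(M^{−2})` including the boundary of `Ω`.
* `cut_ne_zero_bounds` — `cut W J x ≠ 0 ⇒ (2J_μ − 1)W < x_μ < (2J_μ + 2)W` for every `μ` (support in a cube of side `3W`).
* **`sum_cut_eq_one`** — on the aligned box, `Σ_{J ∈ Π_μ{0..K_μ}} cut W J x = 1` (`Finset.prod_univ_sum` × the 1-D partition of unity
  `NE7K1LinWalkProfile.sum_Phi_eq_one`).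

HONEST FRAMING: [folklore] finite products and sums; nothing of Bałaban's asserted; no `sorry`.  Census only; NO letter ∕ tag ∕ size of NE7
moves; NE7 NOT PRINTED ∕ NOT PROVED; spine 0∕9; FIXED FINITE T⁴, rung (B)+1; NOT infinite volume, NOT mass gap, NOT Clay.  HONEST
DEPENDENCY: continuum YM on T⁴ ⇐ BetaPertH ∧ nine spine estimates (0/9 proved); BetaPertH ⇐ (D1) ∧ (D4) ∧ CAP+tail; G-an2-4 gates asym,
D1 and NE2/3/4.
-/

noncomputable section

open Finset

namespace Summit.QuantumFields.BalabanUV.T4Continuum.NE7K1LinWalkCubes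

open NE7K1LinWalkProfile
open Literature.MathematicalPhysics.QuantumFieldTheory.Balaban1983to89
open Literature.MathematicalPhysics.QuantumFieldTheory.Balaban1983to89.B4Reflection242
open Literature.MathematicalPhysics.QuantumFieldTheory.Balaban1983to89.B4BoxCov237
open Literature.MathematicalPhysics.QuantumFieldTheory.Balaban1983to89.B4Lower18

variable {d : ℕ}

/-! ### §1 Products of factors bounded by one: the tree's `JiangNewman.abs_prod_sub_prod_le` (telescoping
`|Π_s f − Π_s g| ≤ Σ_s |f − g|` for factors bounded by one) is reused BY NAME. -/

/-! ### §2 The product cut-off and its first differences -/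

/-- the argument of the `μ`-th factor: `x_μ∕W − 2J_μ + 1`. [folklore] -/
def arg (W : ℕ) (J : Fin (d + 1) → ℕ) (x : Fin (d + 1) → ℤ) (μ : Fin (d + 1)) : ℝ :=
  (x μ : ℝ) / W - 2 * (J μ : ℝ) + 1

/-- **THE PRODUCT CUT-OFF** with label `J ∈ ℕ^{d+1}` on scale `W`: `cut W J x = Π_μ Φ(x_μ∕W − 2J_μ + 1)` (B4's `h_j`, squared-free).
[cite: Balaban1983RegularityDecay, (2.2) p.575 «h_j», dictionary] [folklore] -/
def cut (W : ℕ) (J : Fin (d + 1) → ℕ) (x : Fin (d + 1) → ℤ) : ℝ := ∏ μ, Phi (arg W J x μ)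

/-- `0 ≤ cut ≤ 1`. [folklore] -/
theorem cut_mem_Icc (W : ℕ) (J : Fin (d + 1) → ℕ) (x : Fin (d + 1) → ℤ) : 0 ≤ cut W J x ∧ cut W J x ≤ 1 :=
  ⟨Finset.prod_nonneg fun _ _ => (Phi_mem_Icc _).1,
    Finset.prod_le_one (fun _ _ => (Phi_mem_Icc _).1) fun _ _ => (Phi_mem_Icc _).2⟩

/-- `|cut| ≤ 1`. [folklore] -/
theorem abs_cut_le_one (W : ℕ) (J : Fin (d + 1) → ℕ) (x : Fin (d + 1) → ℤ) : |cut W J x| ≤ 1 := by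
  have := cut_mem_Icc W J x
  rw [abs_le]; constructor <;> linarith [this.1]

/-- **LIPSCHITZ**: `|cut x − cut y| ≤ (4∕W)·Σ_μ |x_μ − y_μ|` (`W ≥ 1`). [folklore] -/
theorem abs_cut_sub_cut_le {W : ℕ} (hW : 1 ≤ W) (J : Fin (d + 1) → ℕ) (x y : Fin (d + 1) → ℤ) :
    |cut W J x - cut W J y| ≤ 4 / (W : ℝ) * ∑ μ, |(x μ : ℝ) - y μ| := by
  have hW0 : (0 : ℝ) < W := by exact_mod_cast hW
  unfold cut
  refine (Literature.Probability.LatticeModels.JiangNewman.abs_prod_sub_prod_le _ (fun μ _ => abs_Phi_le_one _)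
    (fun μ _ => abs_Phi_le_one _)).trans ?_
  rw [Finset.mul_sum]
  refine Finset.sum_le_sum fun μ _ => ?_
  refine (abs_Phi_sub_Phi_le _ _).trans (le_of_eq ?_)
  rw [arg, arg, show (x μ : ℝ) / W - 2 * (J μ : ℝ) + 1 - ((y μ : ℝ) / W - 2 * (J μ : ℝ) + 1) = ((x μ : ℝ) - y μ) / W by ring,
    abs_div, abs_of_pos hW0]
  ring

/-- nearest neighbours are at `ℓ¹`-distance one: `Σ_ν |x_ν − (x ± e_μ)_ν| = 1`. [folklore] -/
theorem sum_abs_sub_of_mem_nbrs {x y : Fin (d + 1) → ℤ} (h : y ∈ nbrs x) : ∑ ν, |(x ν : ℝ) - y ν| = 1 := by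
  obtain ⟨μ, hμ | hμ⟩ := mem_nbrs.1 h
  · subst hμ
    rw [Finset.sum_eq_single μ]
    · simp
    · intro ν _ hν; simp [hν]
    · intro hμ'; exact absurd (Finset.mem_univ μ) hμ'
  · subst hμ
    rw [Finset.sum_eq_single μ]
    · simp
    · intro ν _ hν; simp [hν]
    · intro hμ'; exact absurd (Finset.mem_univ μ) hμ'

/-- **ACROSS A BOND**: `|cut x − cut y| ≤ 4∕W` for nearest neighbours. [folklore] -/
theorem abs_cut_sub_cut_of_mem_nbrs {W : ℕ} (hW : 1 ≤ W) (J : Fin (d + 1) → ℕ) {x y : Fin (d + 1) → ℤ} (h : y ∈ nbrs x) :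
    |cut W J x - cut W J y| ≤ 4 / (W : ℝ) := by
  have := abs_cut_sub_cut_le hW J x y
  rwa [sum_abs_sub_of_mem_nbrs h, mul_one] at this

/-- two sites of the same `n`-block differ by less than `n` in every coordinate. [folklore] -/
theorem abs_sub_le_of_blk_eq {n : ℕ} (hn : 1 ≤ n) {x y : Fin (d + 1) → ℤ} (h : blk n x = blk n y) (μ : Fin (d + 1)) :
    |(x μ : ℝ) - y μ| ≤ n := by
  have hn0 : (0 : ℤ) < n := by exact_mod_cast hn
  have hq : x μ / (n : ℤ) = y μ / (n : ℤ) := congrFun h μ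
  have hx := Int.emod_add_mul_ediv (x μ) n
  have hy := Int.emod_add_mul_ediv (y μ) n
  have hx0 := Int.emod_nonneg (x μ) (ne_of_gt hn0)
  have hy0 := Int.emod_nonneg (y μ) (ne_of_gt hn0)
  have hx1 := Int.emod_lt_of_pos (x μ) hn0
  have hy1 := Int.emod_lt_of_pos (y μ) hn0
  have hint : |x μ - y μ| ≤ (n : ℤ) := by
    rw [abs_le]; constructor <;> nlinarith
  have : |((x μ - y μ : ℤ) : ℝ)| ≤ ((n : ℤ) : ℝ) := by exact_mod_cast hint
  simpa using this

/-- **INSIDE A BLOCK**: `|cut x − cut y| ≤ 4(d+1)n∕W` when `blk n x = blk n y`. [folklore] -/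
theorem abs_cut_sub_cut_of_blk_eq {W n : ℕ} (hW : 1 ≤ W) (hn : 1 ≤ n) (J : Fin (d + 1) → ℕ) {x y : Fin (d + 1) → ℤ}
    (h : blk n x = blk n y) : |cut W J x - cut W J y| ≤ 4 * ((d : ℝ) + 1) * n / W := by
  have hW0 : (0 : ℝ) < W := by exact_mod_cast hW
  refine (abs_cut_sub_cut_le hW J x y).trans ?_
  have hs : ∑ μ : Fin (d + 1), |(x μ : ℝ) - y μ| ≤ ((d : ℝ) + 1) * n := by
    refine (Finset.sum_le_sum fun μ _ => abs_sub_le_of_blk_eq hn h μ).trans ?_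
    simp only [Finset.sum_const, Finset.card_univ, Fintype.card_fin, nsmul_eq_mul, Nat.cast_add, Nat.cast_one, le_refl]
  calc 4 / (W : ℝ) * ∑ μ, |(x μ : ℝ) - y μ| ≤ 4 / (W : ℝ) * (((d : ℝ) + 1) * n) :=
        mul_le_mul_of_nonneg_left hs (by positivity)
    _ = 4 * ((d : ℝ) + 1) * n / W := by ring

/-! ### §3 One factor moves: axis second differences and the faces -/

/-- splitting off the `μ`-th factor. [folklore] -/
theorem cut_eq_mul_prod_erase (W : ℕ) (J : Fin (d + 1) → ℕ) (x : Fin (d + 1) → ℤ) (μ : Fin (d + 1)) :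
    cut W J x = Phi (arg W J x μ) * ∏ ν ∈ univ.erase μ, Phi (arg W J x ν) := by
  rw [cut, ← Finset.mul_prod_erase univ (fun ν => Phi (arg W J x ν)) (Finset.mem_univ μ)]

/-- the other factors do not see a move along `e_μ`. [folklore] -/
theorem prod_erase_arg_add_smul_uvec (W : ℕ) (J : Fin (d + 1) → ℕ) (x : Fin (d + 1) → ℤ) (μ : Fin (d + 1)) (c : ℤ) :
    ∏ ν ∈ univ.erase μ, Phi (arg W J (x + c • uvec μ) ν) = ∏ ν ∈ univ.erase μ, Phi (arg W J x ν) :=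
  Finset.prod_congr rfl fun ν hν => by
    have hne : ν ≠ μ := Finset.ne_of_mem_erase hν
    simp [arg, uvec_apply_ne hne]

/-- the remaining product is bounded by one. [folklore] -/
theorem abs_prod_erase_le_one (W : ℕ) (J : Fin (d + 1) → ℕ) (x : Fin (d + 1) → ℤ) (μ : Fin (d + 1)) :
    |∏ ν ∈ univ.erase μ, Phi (arg W J x ν)| ≤ 1 := by
  rw [Finset.abs_prod]
  exact Finset.prod_le_one (fun ν _ => abs_nonneg _) fun ν _ => abs_Phi_le_one _

/-- the `μ`-th argument after a move by `c·e_μ`. [folklore] -/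
theorem arg_add_smul_uvec (W : ℕ) (J : Fin (d + 1) → ℕ) (x : Fin (d + 1) → ℤ) (μ : Fin (d + 1)) (c : ℤ) :
    arg W J (x + c • uvec μ) μ = arg W J x μ + (c : ℝ) / W := by
  simp [arg, uvec_apply_same]; ring

/-- **AXIS SECOND DIFFERENCES ARE `O(W^{−2})`**: `|cut(x+e_μ) + cut(x−e_μ) − 2cut(x)| ≤ 32∕W²`. [cite: Balaban1983RegularityDecay, p.575 «|Δh_j| = O(M⁻²)», dictionary] [folklore] -/
theorem abs_cut_secondDiff_le {W : ℕ} (hW : 1 ≤ W) (J : Fin (d + 1) → ℕ) (x : Fin (d + 1) → ℤ) (μ : Fin (d + 1)) :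
    |cut W J (x + uvec μ) + cut W J (x - uvec μ) - 2 * cut W J x| ≤ 32 / (W : ℝ) ^ 2 := by
  have hW0 : (0 : ℝ) < W := by exact_mod_cast hW
  have e1 : x + uvec μ = x + (1 : ℤ) • uvec μ := by simp
  have e2 : x - uvec μ = x + (-1 : ℤ) • uvec μ := by simp [sub_eq_add_neg]
  rw [cut_eq_mul_prod_erase W J (x + uvec μ) μ, cut_eq_mul_prod_erase W J (x - uvec μ) μ, cut_eq_mul_prod_erase W J x μ,
    e1, e2, prod_erase_arg_add_smul_uvec, prod_erase_arg_add_smul_uvec, arg_add_smul_uvec, arg_add_smul_uvec]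
  set R := ∏ ν ∈ univ.erase μ, Phi (arg W J x ν)
  set t := arg W J x μ
  have e3 : Phi (t + ((1 : ℤ) : ℝ) / W) * R + Phi (t + ((-1 : ℤ) : ℝ) / W) * R - 2 * (Phi t * R) =
      (Phi (t + 1 / W) + Phi (t - 1 / W) - 2 * Phi t) * R := by push_cast; ring
  rw [e3, abs_mul]
  have h1 := abs_Phi_secondDiff_le (t := t) (h := 1 / (W : ℝ)) (by positivity)
  have h2 := abs_prod_erase_le_one W J x μ
  calc |Phi (t + 1 / W) + Phi (t - 1 / W) - 2 * Phi t| * |R| ≤ 32 * (1 / (W : ℝ)) ^ 2 * 1 :=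
        mul_le_mul h1 h2 (abs_nonneg _) (by positivity)
    _ = 32 / (W : ℝ) ^ 2 := by ring

/-- **LOWER FACE**: at `x_μ = 0` the cut-off does not change across the bond to `x + e_μ` (`W ≥ 1`). [folklore] -/
theorem cut_add_uvec_eq_of_eq_zero {W : ℕ} (hW : 1 ≤ W) (J : Fin (d + 1) → ℕ) {x : Fin (d + 1) → ℤ} {μ : Fin (d + 1)}
    (hx : x μ = 0) : cut W J (x + uvec μ) = cut W J x := by
  have hW0 : (0 : ℝ) < W := by exact_mod_cast hW
  have hW1 : 1 / (W : ℝ) ≤ 1 := by rw [div_le_one hW0]; exact_mod_cast hW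
  have e1 : x + uvec μ = x + (1 : ℤ) • uvec μ := by simp
  rw [cut_eq_mul_prod_erase W J (x + uvec μ) μ, cut_eq_mul_prod_erase W J x μ, e1, prod_erase_arg_add_smul_uvec,
    arg_add_smul_uvec]
  congr 1
  have ht : arg W J x μ = 1 - 2 * ((J μ : ℤ) : ℝ) + 0 := by simp [arg, hx]; ring
  rw [ht, show 1 - 2 * ((J μ : ℤ) : ℝ) + 0 + ((1 : ℤ) : ℝ) / W = 1 - 2 * ((J μ : ℤ) : ℝ) + 1 / W by push_cast; ring]
  exact Phi_flat_int (J μ : ℤ) (by positivity) hW1 le_rfl zero_le_one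

/-- **UPPER FACE**: at `x_μ = (2K+1)W − 1` the cut-off does not change across the bond to `x − e_μ` (`W ≥ 2`). [folklore] -/
theorem cut_sub_uvec_eq_of_eq_top {W : ℕ} (hW : 2 ≤ W) (J : Fin (d + 1) → ℕ) (K : ℕ) {x : Fin (d + 1) → ℤ} {μ : Fin (d + 1)}
    (hx : x μ = (2 * K + 1) * W - 1) : cut W J (x - uvec μ) = cut W J x := by
  have hW0 : (0 : ℝ) < W := by positivity
  have hW2 : (2 : ℝ) ≤ W := by exact_mod_cast hW
  have e2 : x - uvec μ = x + (-1 : ℤ) • uvec μ := by simp [sub_eq_add_neg]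
  rw [cut_eq_mul_prod_erase W J (x - uvec μ) μ, cut_eq_mul_prod_erase W J x μ, e2, prod_erase_arg_add_smul_uvec,
    arg_add_smul_uvec]
  congr 1
  have ht : arg W J x μ = 1 - 2 * (((J μ : ℤ) - K : ℤ) : ℝ) + (1 - 1 / W) := by
    simp only [arg, hx]; push_cast; field_simp; ring
  have ht' : arg W J x μ + ((-1 : ℤ) : ℝ) / W = 1 - 2 * (((J μ : ℤ) - K : ℤ) : ℝ) + (1 - 2 / W) := by
    rw [ht]; push_cast; ring
  rw [ht', ht]
  have h1 : 1 / (W : ℝ) ≤ 1 := by rw [div_le_one hW0]; linarith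
  have h2 : 2 / (W : ℝ) ≤ 1 := by rw [div_le_one hW0]; linarith
  have h3 : (0 : ℝ) ≤ 2 / W := by positivity
  have h4 : (0 : ℝ) ≤ 1 / W := by positivity
  exact Phi_flat_int _ (by linarith) (by linarith) (by linarith) (by linarith)

/-- membership of `x ± e_μ` in a box, read on the `μ`-th coordinate. [folklore] -/
theorem add_smul_uvec_mem_boxDom {N : Fin (d + 1) → ℕ} {x : Fin (d + 1) → ℤ} (hx : x ∈ boxDom N) (μ : Fin (d + 1)) (c : ℤ) :
    x + c • uvec μ ∈ boxDom N ↔ 0 ≤ x μ + c ∧ x μ + c < N μ := by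
  rw [mem_boxDom] at hx ⊢
  constructor
  · intro h; simpa [uvec_apply_same] using h μ
  · intro h ν
    by_cases hν : ν = μ
    · subst hν; simpa [uvec_apply_same] using h
    · simpa [uvec_apply_ne hν] using hx ν

/-- **THE NEUMANN SECOND DIFFERENCE IS `O(W^{−2})` AT EVERY SITE OF THE ALIGNED BOX** `Π_μ[0,(2K_μ+1)W)` (`W ≥ 2`): interior sites
carry a full second difference, face sites a vanishing one-sided difference. [cite: Balaban1983RegularityDecay, p.575 «|Δh_j| = O(M⁻²)», dictionary incl. ∂Ω] [folklore] -/
theorem abs_dirDiff_le {W : ℕ} (hW : 2 ≤ W) (K : Fin (d + 1) → ℕ) (J : Fin (d + 1) → ℕ) {x : Fin (d + 1) → ℤ}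
    (hx : x ∈ boxDom fun μ => (2 * K μ + 1) * W) (μ : Fin (d + 1)) :
    |(if x + uvec μ ∈ boxDom (fun μ => (2 * K μ + 1) * W) then cut W J x - cut W J (x + uvec μ) else 0) +
        (if x - uvec μ ∈ boxDom (fun μ => (2 * K μ + 1) * W) then cut W J x - cut W J (x - uvec μ) else 0)| ≤
      32 / (W : ℝ) ^ 2 := by
  have hW1 : 1 ≤ W := le_trans (by norm_num) hW
  have hpos : (0 : ℝ) ≤ 32 / (W : ℝ) ^ 2 := by positivity
  have hxμ := (mem_boxDom.1 hx) μ
  have e1 : x + uvec μ = x + (1 : ℤ) • uvec μ := by simp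
  have e2 : x - uvec μ = x + (-1 : ℤ) • uvec μ := by simp [sub_eq_add_neg]
  have hup : x + uvec μ ∈ boxDom (fun μ => (2 * K μ + 1) * W) ↔ x μ + 1 < ((2 * K μ + 1) * W : ℕ) := by
    rw [e1, add_smul_uvec_mem_boxDom hx]; constructor
    · exact fun h => h.2
    · exact fun h => ⟨by linarith [hxμ.1], h⟩
  have hdn : x - uvec μ ∈ boxDom (fun μ => (2 * K μ + 1) * W) ↔ 1 ≤ x μ := by
    rw [e2, add_smul_uvec_mem_boxDom hx]; constructor
    · exact fun h => by linarith [h.1]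
    · exact fun h => ⟨by linarith, by linarith [hxμ.2]⟩
  by_cases h1 : x μ + 1 < ((2 * K μ + 1) * W : ℕ)
  · rw [if_pos (hup.2 h1)]
    by_cases h2 : 1 ≤ x μ
    · rw [if_pos (hdn.2 h2)]
      have := abs_cut_secondDiff_le hW1 J x μ
      rw [abs_sub_comm] at this
      refine le_trans (le_of_eq ?_) this
      congr 1; ring
    · rw [if_neg (fun h => h2 (hdn.1 h)), add_zero]
      have hx0 : x μ = 0 := by push Not at h2; linarith [hxμ.1]
      rw [cut_add_uvec_eq_of_eq_zero hW1 J hx0, sub_self, abs_zero]; exact hpos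
  · rw [if_neg (fun h => h1 (hup.1 h)), zero_add]
    have hxtop : x μ = (2 * K μ + 1) * W - 1 := by
      push Not at h1
      have := hxμ.2; push_cast at this h1 ⊢; omega
    have h2 : 1 ≤ x μ := by
      rw [hxtop]
      have : (2 : ℤ) ≤ W := by exact_mod_cast hW
      nlinarith
    rw [if_pos (hdn.2 h2), cut_sub_uvec_eq_of_eq_top hW J (K μ) hxtop, sub_self, abs_zero]; exact hpos

/-! ### §4 Support and the partition of unity on the aligned box -/

/-- **SUPPORT IN A CUBE OF SIDE `3W`**: `cut W J x ≠ 0 ⇒ (2J_μ − 1)W < x_μ < (2J_μ + 2)W` for every `μ`. [folklore] -/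
theorem cut_ne_zero_bounds {W : ℕ} (hW : 1 ≤ W) {J : Fin (d + 1) → ℕ} {x : Fin (d + 1) → ℤ} (h : cut W J x ≠ 0)
    (μ : Fin (d + 1)) : (2 * (J μ : ℝ) - 1) * W < x μ ∧ (x μ : ℝ) < (2 * (J μ : ℝ) + 2) * W := by
  have hW0 : (0 : ℝ) < W := by exact_mod_cast hW
  have hμ : Phi (arg W J x μ) ≠ 0 := fun h0 => h (Finset.prod_eq_zero (Finset.mem_univ μ) h0)
  have h1 : 0 < arg W J x μ := by
    by_contra hle; push Not at hle; exact hμ (Phi_of_nonpos hle)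
  have h2 : arg W J x μ < 3 := by
    by_contra hle; push Not at hle; exact hμ (Phi_of_three_le hle)
  simp only [arg] at h1 h2
  constructor
  · have := mul_lt_mul_of_pos_right h1 hW0
    rw [zero_mul] at this
    have e : ((x μ : ℝ) / W - 2 * (J μ : ℝ) + 1) * W = x μ - (2 * (J μ : ℝ) - 1) * W := by field_simp; ring
    linarith [e ▸ this]
  · have := mul_lt_mul_of_pos_right h2 hW0
    have e : ((x μ : ℝ) / W - 2 * (J μ : ℝ) + 1) * W = x μ - (2 * (J μ : ℝ) - 1) * W := by field_simp; ring
    rw [e] at this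
    linarith

/-- **PARTITION OF UNITY ON THE ALIGNED BOX**: for `x ∈ Π_μ[0,(2K_μ+1)W)`, `Σ_{J ∈ Π_μ{0,…,K_μ}} cut W J x = 1` (`W ≥ 1`).
[cite: Balaban1983RegularityDecay, (2.2) p.575 «Σ_j h_j² = 1», dictionary] [folklore] -/
theorem sum_cut_eq_one {W : ℕ} (hW : 1 ≤ W) (K : Fin (d + 1) → ℕ) {x : Fin (d + 1) → ℤ}
    (hx : x ∈ boxDom fun μ => (2 * K μ + 1) * W) :
    ∑ J ∈ Fintype.piFinset (fun μ => Finset.range (K μ + 1)), cut W J x = 1 := by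
  have hW0 : (0 : ℝ) < W := by exact_mod_cast hW
  have h1 : ∑ J ∈ Fintype.piFinset (fun μ => Finset.range (K μ + 1)), cut W J x =
      ∏ μ : Fin (d + 1), ∑ j ∈ Finset.range (K μ + 1), Phi (((x μ : ℝ) / W + 1) - 2 * (j : ℝ)) := by
    rw [Finset.prod_univ_sum]
    refine Finset.sum_congr rfl fun J _ => Finset.prod_congr rfl fun μ _ => ?_
    simp only [arg]; ring_nf
  rw [h1]
  refine Finset.prod_eq_one fun μ _ => sum_Phi_eq_one ?_ ?_
  · have := ((mem_boxDom.1 hx) μ).1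
    have : (0 : ℝ) ≤ x μ := by exact_mod_cast this
    linarith [div_nonneg this hW0.le]
  · have h2 := ((mem_boxDom.1 hx) μ).2
    have h3 : (x μ : ℝ) < ((2 * K μ + 1) * W : ℕ) := by exact_mod_cast h2
    push_cast at h3
    have h4 : (x μ : ℝ) / W < 2 * (K μ : ℝ) + 1 := by
      rw [div_lt_iff₀ hW0]; linarith
    linarith

end Summit.QuantumFields.BalabanUV.T4Continuum.NE7K1LinWalkCubes

end
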